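import Literature.NumberTheory.EllipticCurves.LambdaAdicSelmerDataUnramified
import HarnessLib

/-!
# Transport of the bad-place clause `(S)`: inertia-torsion of the layer classes ⇒ `p^a • loc_v (f s)` unramified

Topic `NumberTheory/EllipticCurves`; namespaces `Literature.NumberTheory.EllipticCurves.ZpExtension` (§1),
`WeierstrassCurve` (§2), `WeierstrassCurve.LambdaAdicSelmerData` (§3). THEOREMS ONLY (no definition, no named fact, no instance, no `sorry`).

Setting as in `LambdaAdicSelmerDataUnramified`: `𝔖 = 𝔖_p(K_∞)` (`D : V.LambdaAdicSelmerData κ γ`), Howard's twisted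
coefficients `T_𝔮/p^k = E[p^k] ⊗ A_{m,k}` at `κ⁻ = κ.unitTwist (-1)`, the compact control map
`f = toEisensteinH1Linear : 𝔖 →ₗ[Λ] H¹(K, T_𝔮)` with `proj k (f s) = cor_{Γ_n}^{Γ_K} ((1 ⊗ ·)_* (D.proj n s k))`.

Clause `(S)` of the place-by-place Selmer criterion `ZpExtension.EisensteinH1Data.mem_ordinarySelmer_of_local`
(`ZpExtensionEisensteinSelmerLocalCriterion`) asks, at a bad place `v ∤ p`, for an exponent `a` with
`p^a • loc_v (proj k (f s)) ∈ H¹_{ur}(K_v, T_𝔮/p^k)` for all `k` (the local family is then SATURATED for the unramified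
core). This file is the COHOMOLOGICAL TRANSPORT reducing `(S)` to a statement about the layer classes
`D.proj n s k ∈ Sel^{(p^k)}(E/K_n)` alone:

  `(S-loc)_a`: for all `n k g`, `p^a` kills the pull-back of the conjugate `g · (D.proj n s k)` to
  `Γ_{(K_v)^{nr}} ×_{Γ_K} Γ_n` (the inertia group of `K_v`, intersected with `Γ_n`),

in the currency of `ZpExtension.res_coresEisenstein_mem_unramifiedSubgroup` (`comapRestrict`, `resPairHom`, `idPairHom`,
`unramifiedRestrictHom`). The arithmetic content of `(S-loc)` — `a = v_p` of the component index, uniformly in the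
unramified tower, via `E₀` being `p`-divisible over `(K_v)^{nr}` — is NOT in this file; §2 reduces it to exactly that
point-divisibility statement (`hdiv`).

* §1 `nsmul_res_coresEisenstein_mem_unramifiedSubgroup` — generic: if `p^a` kills the pull-back to
  `Γ_{(K_v)^{nr}} ×_{Γ_K} N` of every conjugate of `θ ∈ H¹(N, M)`, then `p^a • loc_v (cor_N^{Γ_K} (1 ⊗ θ))` is unramified
  (`p^a • cor (1 ⊗ θ) = cor (1 ⊗ p^a θ)` and the unramified lemma for `p^a θ`).
* §1 `nsmul_map_comapRestrict_oneCocycleClass_eq_zero_of_exists` — generic: `a • [z]` dies along `(φ|, id_M)` when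
  `a • z ∘ φ|` is the coboundary of some `w ∈ M`.
* §2 `WeierstrassCurve.nsmul_map_comapRestrict_unramifiedRestrictHom_eq_zero` — the ARITHMETIC REDUCTION of `(S-loc)`:
  for a class of `H¹(H, E[p^k])` with the local Kummer condition at `v`, `p^c` kills its pull-back to
  `Γ_{(K_v)^{nr}} ×_{Γ_K} H` PROVIDED every `H_{K_v}`-rational `R ∈ E(K̄_v)` admits `Q` fixed by `I_{K_v} ∩ H_{K_v}` with
  `p^k Q = p^c R` (hypothesis `hdiv`: the `E₀`/component-group arithmetic, NOT proved here); cocycle computation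
  `p^c (P^τ − P) = Q'^τ − Q'`, `Q' = p^c P − Q ∈ E[p^k]` (all `p^k`-torsion of `E(K̄_v)` is algebraic:
  `exists_pointsMapOfEmb_eq_of_nsmul_eq_zero`).
* §3 `nsmul_localization_eisensteinComponent_mem_unramifiedSubgroup`, `nsmul_proj_conjMap_eq_zero_of_divisible`,
  `nsmul_localization_proj_toEisensteinH1Linear_mem_unramifiedSubgroup_of_divisible`,
  **`nsmul_localization_proj_toEisensteinH1Linear_mem_unramifiedSubgroup`**, **`toEisensteinH1Linear_hS`** — `(S-loc)_a`
  for `s` at `v` ⇒ `p^a • loc_v (proj k (f s)) ∈ H¹_{ur}` for all `k`; packaged over a finite set `S` of places in the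
  exact shape of the hypothesis `hS` of `mem_ordinarySelmer_of_local`.

References: Howard, *Compos. Math.* 140 (2004), Def. 2.1.1 (propagation), §2.2 Lemma 2.2.7; Mazur–Rubin, *Kolyvagin
systems* (2004), Lemma 5.3.13; Silverman, *AEC* (2009), X.§4 (proof of Thm. 4.2(b)), VII.§6; Greenberg, LNM 1716 (1999), §2;
Neukirch–Schmidt–Wingberg (2008), I §5 (1.5.6)–(1.5.7). No summit statement is proved here.
-/

noncomputable section

open scoped TensorProduct Topology ContRepresentation Classical NumberField
open Field CategoryTheory NumberField IsDedekindDomain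
open Literature.NumberTheory.GaloisRepresentations Literature.NumberTheory.EllipticCurves
open Literature.NumberTheory.GaloisRepresentations.DiscreteGaloisModule (unramifiedSubgroup)
open Literature.NumberTheory.EllipticCurves.ZpExtension (eisensteinLevel)

universe u

/-! ## §1 Generic transport: `p^a`-torsion on `Γ_{(K_v)^{nr}} ×_{Γ_K} N` ⇒ `p^a • loc_v (cor (1 ⊗ θ))` unramified -/

namespace Literature.NumberTheory.EllipticCurves.ZpExtension

variable {K : Type u} [Field K] [NumberField K] {p : ℕ} [hp : Fact p.Prime] (κ : ZpExtension K p)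
variable {M : Type u} [AddCommGroup M] [TopologicalSpace M] [DiscreteTopology M]
variable (ρ : DiscreteGaloisModule K M) {m : ℕ} (hm : 1 ≤ m) (k : ℕ)
  (N : Subgroup (absoluteGaloisGroup K)) [N.Normal] (hN : N ≤ κ.layerSubgroup (eisensteinLevel (p := p) hm k))
  (hNo : IsOpen (N : Set (absoluteGaloisGroup K))) [Fintype (absoluteGaloisGroup K ⧸ N)]
  (v : HeightOneSpectrum (𝓞 K))

omit [NumberField K] [N.Normal] [Fintype (absoluteGaloisGroup K ⧸ N)] in
/-- **A multiple of a class which is a coboundary on `φ⁻¹N` dies along the restricted pair `(φ|, id_M)`**: if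
`a • z(φ| h) = (φ h) • w - w` for all `h ∈ φ⁻¹N` and some `w ∈ M`, then `a • H¹(φ|, id) [z] = [a • z ∘ φ|] = [∂w] = 0` in
`H¹(φ⁻¹N, M)`. (Generic in the discrete `Γ_K`-module `ρ`; sequel to the tree's
`map_comapRestrict_oneCocycleClass_eq_zero_of_forall_apply_eq_zero`, the case `a = 1`, `w = 0`.)
[cite: SerreLocalFields1979, VII §5] [cite: NeukirchSchmidtWingberg2008, I §5] -/
theorem nsmul_map_comapRestrict_oneCocycleClass_eq_zero_of_exists {L : Type u} [Field L]
    (φ : absoluteGaloisGroup L →ₜ* absoluteGaloisGroup K) (z : contOneCocycles (subgroupRep ρ.toTopRep N)) (a : ℕ) (w : M)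
    (hz : ∀ h : N.comap (φ : absoluteGaloisGroup L →* absoluteGaloisGroup K),
      a • z.1 (comapRestrict N φ h) = ρ (φ h) w - w) :
    a • ContinuousCohomology.map (comapRestrict N φ)
        (resPairHom ρ.toTopRep (DiscreteGaloisModule.toTopRep (ContinuousRep.restrict ρ φ)) φ (idPairHom ρ φ) N) 1
        (oneCocycleClass _ z) = 0 := by
  rw [← map_nsmul, ← oneCocycleClassₗ_apply, ← map_nsmul, oneCocycleClassₗ_apply, map_pair_oneCocycleClass,
    oneCocycleClass_eq_zero_iff]
  refine ⟨w, fun h ↦ ?_⟩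
  rw [contOneCocycles.pullback_apply, resPairHom_hom_apply, idPairHom_hom_apply]
  exact hz h

/-- **Saturated transport.** If a fixed power `p^a` kills the pull-back to `Γ_{(K_v)^{nr}} ×_{Γ_K} N` of every conjugate
`g · θ` of `θ ∈ H¹(N, M)` (i.e. `p^a θ` restricted to the inertia groups of `K̄^N` above `v` vanishes), then
`p^a • loc_v (cor_N^{Γ_K} (1 ⊗ θ))` lies in the unramified subgroup `H¹_{ur}(K_v, M ⊗ A_{m,k}(ψ))`: by additivity
`p^a • cor (1 ⊗ θ) = cor (1 ⊗ p^a θ)` and `g · (p^a θ) = p^a (g · θ)`, so `res_coresEisenstein_mem_unramifiedSubgroup` applies to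
`p^a θ`. This is the shape of the `(S)`-clause (saturation for the unramified core) of Howard's Selmer structure `F_𝔮` at the
places of `Σ` away from `p`. [cite: Howard2004HeegnerKolyvagin, Def. 2.1.1 and Lemma 2.2.7] [cite: MazurRubinMemoirs2004, Lemma 5.3.13]
[cite: NeukirchSchmidtWingberg2008, I §5 (1.5.6)–(1.5.7)] -/
theorem nsmul_res_coresEisenstein_mem_unramifiedSubgroup (θ : continuousCohomology 1 (subgroupRep ρ.toTopRep N)) (a : ℕ)
    (hθ : ∀ g : absoluteGaloisGroup K,
      p ^ a • ContinuousCohomology.map (comapRestrict N (unramifiedRestrictHom v))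
        (resPairHom ρ.toTopRep (DiscreteGaloisModule.toTopRep (ContinuousRep.restrict ρ (unramifiedRestrictHom v)))
          (unramifiedRestrictHom v) (idPairHom ρ (unramifiedRestrictHom v)) N) 1
        (conjMap ρ.toTopRep N g 1 θ) = 0) :
    p ^ a • galoisCohomology.res (κ.eisensteinTwist ρ hm k) (v.adicCompletion K) 1 (κ.coresEisenstein ρ hm k N hN hNo θ) ∈
      unramifiedSubgroup (GaloisRep.toLocal v (κ.eisensteinTwist ρ hm k)) 1 := by
  rw [← map_nsmul, ← map_nsmul]
  refine κ.res_coresEisenstein_mem_unramifiedSubgroup ρ hm k N hN hNo v (p ^ a • θ) fun g ↦ ?_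
  rw [map_nsmul, map_nsmul]
  exact hθ g

end Literature.NumberTheory.EllipticCurves.ZpExtension

/-! ## §2 Kummer classes at a bad place: `p^c` kills them on inertia, given `p`-divisibility over `(K_v)^{nr}` -/

namespace WeierstrassCurve

variable {K : Type u} [Field K] [NumberField K] (V : WeierstrassCurve K) [V.IsElliptic] {p : ℕ} [hp : Fact p.Prime]

/-- **The bad-place Kummer argument, cocycle form, for a subgroup `H ≤ Γ_K`** (Silverman X.4.2(b) with the component
group let in). Let `y ∈ H¹(H, E[p^k])` satisfy the local (Kummer/Selmer) condition at `v` along the chosen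
`ι : K̄ → K̄_v`: a representative cocycle `z` has `ι_* z(res τ) = P^τ - P` on `H_{K_v} = res⁻¹ H` for some `P ∈ E(K̄_v)`,
so `R = p^k P` is `H_{K_v}`-rational. HYPOTHESIS `hdiv` (the arithmetic of `E` at `v`, to be supplied: `E₀` is
`p`-divisible over the maximal unramified extension and `p^c` pushes `H_{K_v}`-rational points into `E₀` up to
prime-to-`p` index): every `H_{K_v}`-fixed `R` has a `Q` fixed by `I_{K_v} ∩ H_{K_v}` with `p^k Q = p^c R`. Then
`Q' = p^c P - Q ∈ E[p^k]` and `p^c (P^τ - P) = Q'^τ - Q'` for `τ ∈ I_{K_v} ∩ H_{K_v}`: the class `p^c • y` DIES on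
`Γ_{(K_v)^{nr}} ×_{Γ_K} H` (pull-back along `(φ|, id)`, `φ = unramifiedRestrictHom v`).
[cite: SilvermanAEC2009, X.§4 proof of Thm. 4.2(b); VII.§6 (Prop. VII.6.1: finiteness of E/E₀)] [cite: GreenbergLNM1716, §2 (ℓ ≠ p)] -/
theorem nsmul_map_comapRestrict_unramifiedRestrictHom_eq_zero {k : ℕ} {H : Subgroup (absoluteGaloisGroup K)}
    {v : HeightOneSpectrum (𝓞 K)} (c : ℕ)
    (hdiv : ∀ R : localPoints V (v.adicCompletion K),
      (∀ τ ∈ localSubgroupOfEmb H (closureEmb (K := K) (v.adicCompletion K)), τ • R = R) →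
      ∃ Q : localPoints V (v.adicCompletion K),
        (∀ τ ∈ absInertia (v.adicCompletion K),
          τ ∈ localSubgroupOfEmb H (closureEmb (K := K) (v.adicCompletion K)) → τ • Q = Q) ∧
        p ^ k • Q = p ^ c • R)
    (y : V.torsionH1Over ((p : ℤ) ^ k) H)
    (hy : V.localResTorsionOverOfEmb ((p : ℤ) ^ k) H (closureEmb (K := K) (v.adicCompletion K)) y = 0) :
    p ^ c • ContinuousCohomology.map (comapRestrict H (ZpExtension.unramifiedRestrictHom v))
        (resPairHom (V.torsionGaloisModule ((p : ℤ) ^ k)).toTopRep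
          (DiscreteGaloisModule.toTopRep
            (ContinuousRep.restrict (V.torsionGaloisModule ((p : ℤ) ^ k)) (ZpExtension.unramifiedRestrictHom v)))
          (ZpExtension.unramifiedRestrictHom v)
          (ZpExtension.idPairHom (V.torsionGaloisModule ((p : ℤ) ^ k)) (ZpExtension.unramifiedRestrictHom v)) H) 1 y = 0 := by
  obtain ⟨z, rfl⟩ := oneCocycleClass_surjective (subgroupRep (V.torsionGaloisModule ((p : ℤ) ^ k)).toTopRep H) y
  -- the local (Kummer) condition on cocycles: `ι_* z(res x) = x • P - P` on `H_{K_v}`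
  obtain ⟨P, hP⟩ := (CocycleCriteria.resH1Hom_oneCocycleClass_eq_zero_iff _ _ _
    (z : contOneCocycles (discreteTopRep H (geomTorsion V ((p : ℤ) ^ k))))).1 hy
  have hK : ∀ (τ : absoluteGaloisGroup (v.adicCompletion K))
      (hτ : τ ∈ localSubgroupOfEmb H (closureEmb (K := K) (v.adicCompletion K))),
      pointsMapOfEmb V (closureEmb (K := K) (v.adicCompletion K))
        ((z.1 ⟨absGaloisRestrict K (v.adicCompletion K) τ, hτ⟩ : geomTorsion V ((p : ℤ) ^ k)) : geomPoints V) =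
        τ • P - P := fun τ hτ ↦ hP ⟨τ, hτ⟩
  -- the values of `z` are `p^k`-torsion
  have htor : ∀ x : H, p ^ k • ((z.1 x : geomTorsion V ((p : ℤ) ^ k)) : geomPoints V) = 0 := fun x ↦ by
    rw [← natCast_zsmul, Nat.cast_pow]
    exact (Submodule.mem_torsionBy_iff _ _).mp (z.1 x).2
  -- the Galois action commutes with multiples
  have hsm : ∀ (τ : absoluteGaloisGroup (v.adicCompletion K)) (n : ℕ) (X : localPoints V (v.adicCompletion K)),
      τ • (n • X) = n • (τ • X) := fun τ n X ↦ map_nsmul (DistribSMul.toAddMonoidHom _ τ) n X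
  -- `R = p^k P` is `H_{K_v}`-rational
  have hR : ∀ τ ∈ localSubgroupOfEmb H (closureEmb (K := K) (v.adicCompletion K)), τ • (p ^ k • P) = p ^ k • P := by
    intro τ hτ
    have h2 : p ^ k • (τ • P - P) = 0 := by
      rw [← hK τ hτ, ← map_nsmul, htor, map_zero]
    rw [smul_sub, sub_eq_zero] at h2
    rw [hsm, h2]
  obtain ⟨Q, hQI, hQ⟩ := hdiv (p ^ k • P) hR
  -- `Q' = p^c P - Q` is `p^k`-torsion, hence comes from `E[p^k](K̄)`
  have hQ' : p ^ k • (p ^ c • P - Q) = 0 := by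
    rw [smul_sub, hQ, smul_comm, sub_self]
  obtain ⟨Q'', hQ''k, hQ''⟩ := exists_pointsMapOfEmb_eq_of_nsmul_eq_zero (W := V)
    (closureEmb (K := K) (v.adicCompletion K)) (pow_ne_zero k hp.out.ne_zero) hQ'
  have hw : Q'' ∈ geomTorsion V ((p : ℤ) ^ k) :=
    (Submodule.mem_torsionBy_iff _ _).mpr (by rw [← Nat.cast_pow, natCast_zsmul]; exact hQ''k)
  refine ZpExtension.nsmul_map_comapRestrict_oneCocycleClass_eq_zero_of_exists (V.torsionGaloisModule ((p : ℤ) ^ k)) H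
    (ZpExtension.unramifiedRestrictHom v) z (p ^ c) ⟨Q'', hw⟩ fun h ↦ ?_
  -- at `h ∈ Γ_{(K_v)^{nr}} ×_{Γ_K} H`: `τ = res h ∈ I_{K_v}` with `res τ ∈ H`
  have hτI := IsNonarchimedeanLocalField.absGaloisRestrict_maxUnramified_mem_absInertia (v.adicCompletion K)
    (h : absoluteGaloisGroup (IsNonarchimedeanLocalField.maxUnramified (v.adicCompletion K)))
  have hτH : absGaloisRestrict (v.adicCompletion K) (IsNonarchimedeanLocalField.maxUnramified (v.adicCompletion K))
      (h : absoluteGaloisGroup (IsNonarchimedeanLocalField.maxUnramified (v.adicCompletion K))) ∈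
      localSubgroupOfEmb H (closureEmb (K := K) (v.adicCompletion K)) := h.2
  -- compare both sides in `E(K̄_v)` (`ι_*` and `E[p^k] ⊆ E(K̄)` are injective)
  have eL : pointsMapOfEmb V (closureEmb (K := K) (v.adicCompletion K))
      ((p ^ c • z.1 (comapRestrict H (ZpExtension.unramifiedRestrictHom v) h) : geomTorsion V ((p : ℤ) ^ k)) :
        geomPoints V) = p ^ c • (absGaloisRestrict (v.adicCompletion K)
          (IsNonarchimedeanLocalField.maxUnramified (v.adicCompletion K)) h • P - P) := by
    rw [AddSubmonoidClass.coe_nsmul, map_nsmul]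
    exact congrArg _ (hK _ hτH)
  have eR : pointsMapOfEmb V (closureEmb (K := K) (v.adicCompletion K))
      (((V.torsionGaloisModule ((p : ℤ) ^ k)) (ZpExtension.unramifiedRestrictHom v h) ⟨Q'', hw⟩ - ⟨Q'', hw⟩ :
        geomTorsion V ((p : ℤ) ^ k)) : geomPoints V) =
        absGaloisRestrict (v.adicCompletion K) (IsNonarchimedeanLocalField.maxUnramified (v.adicCompletion K)) h •
          (p ^ c • P - Q) - (p ^ c • P - Q) := by
    rw [AddSubgroupClass.coe_sub, map_sub, ← hQ'']
    exact congrArg (· - _) (pointsMapOfEmb_smul (W := V) (closureEmb (K := K) (v.adicCompletion K)) _ Q'')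
  have key : pointsMapOfEmb V (closureEmb (K := K) (v.adicCompletion K))
      ((p ^ c • z.1 (comapRestrict H (ZpExtension.unramifiedRestrictHom v) h) : geomTorsion V ((p : ℤ) ^ k)) :
        geomPoints V) =
      pointsMapOfEmb V (closureEmb (K := K) (v.adicCompletion K))
      (((V.torsionGaloisModule ((p : ℤ) ^ k)) (ZpExtension.unramifiedRestrictHom v h) ⟨Q'', hw⟩ - ⟨Q'', hw⟩ :
        geomTorsion V ((p : ℤ) ^ k)) : geomPoints V) := by
    rw [eL, eR, smul_sub (absGaloisRestrict _ _ _), hQI _ hτI hτH, hsm, smul_sub (p ^ c)]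
    abel
  exact Subtype.ext (pointsMapOfEmb_injective V _ key)

end WeierstrassCurve

/-! ## §3 The clause `(S)` for the image of `𝔖_p(K_∞)` from `(S-loc)` -/

namespace WeierstrassCurve.LambdaAdicSelmerData

variable {K : Type u} [Field K] [NumberField K] {V : WeierstrassCurve K} [V.IsElliptic] {p : ℕ} [hp : Fact p.Prime]
  {κ : ZpExtension K p} {γ : absoluteGaloisGroup K} (D : V.LambdaAdicSelmerData κ γ) {m : ℕ} (hm : 1 ≤ m)

omit [V.IsElliptic] in
/-- **`(S-loc)_a` at layer `n` ⇒ `p^a • loc_v (comp_{k,n} s)` unramified**: if `p^a` kills the pull-back to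
`Γ_{(K_v)^{nr}} ×_{Γ_K} Γ_n` of every conjugate of the layer class `D.proj n s k ∈ Sel^{(p^k)}(E/K_n)`, then
`p^a • loc_v (cor_{Γ_n}^{Γ_K} ((1 ⊗ ·)_* (D.proj n s k))) ∈ H¹_{ur}(K_v, T_𝔮/p^k)`.
[cite: Howard2004HeegnerKolyvagin, Def. 2.1.1 and Lemma 2.2.7] [cite: NeukirchSchmidtWingberg2008, I §5 (1.5.6)–(1.5.7)] -/
theorem nsmul_localization_eisensteinComponent_mem_unramifiedSubgroup (k n : ℕ)
    (hn : eisensteinLevel (p := p) hm k ≤ n) (s : D.S) (v : HeightOneSpectrum (𝓞 K)) (a : ℕ)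
    (hloc : ∀ g : absoluteGaloisGroup K,
      p ^ a • ContinuousCohomology.map (comapRestrict (κ.layerSubgroup n) (ZpExtension.unramifiedRestrictHom v))
        (resPairHom (V.torsionGaloisModule ((p : ℤ) ^ k)).toTopRep
          (DiscreteGaloisModule.toTopRep
            (ContinuousRep.restrict (V.torsionGaloisModule ((p : ℤ) ^ k)) (ZpExtension.unramifiedRestrictHom v)))
          (ZpExtension.unramifiedRestrictHom v)
          (ZpExtension.idPairHom (V.torsionGaloisModule ((p : ℤ) ^ k)) (ZpExtension.unramifiedRestrictHom v))
          (κ.layerSubgroup n)) 1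
        (conjMap (V.torsionGaloisModule ((p : ℤ) ^ k)).toTopRep (κ.layerSubgroup n) g 1 (D.proj n s k)) = 0) :
    p ^ a • galoisCohomology.localization
        ((κ.unitTwist (-1)).eisensteinTwist (V.torsionGaloisModule ((p : ℤ) ^ k)) hm k) (Sum.inr v) 1
        (D.eisensteinComponent hm k n hn s) ∈
      unramifiedSubgroup
        (GaloisRep.toLocal v ((κ.unitTwist (-1)).eisensteinTwist (V.torsionGaloisModule ((p : ℤ) ^ k)) hm k)) 1 := by
  haveI := κ.fintypeQuotientLayer n
  rw [D.eisensteinComponent_apply hm k n hn s]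
  exact (κ.unitTwist (-1)).nsmul_res_coresEisenstein_mem_unramifiedSubgroup (V.torsionGaloisModule ((p : ℤ) ^ k)) hm k
    (κ.layerSubgroup n) (layerSubgroup_le_unitTwist_layerSubgroup hm hn) (κ.isOpen_layerSubgroup n) v
    (D.proj n s k) a hloc

/-- **`(S-loc)_c` at `v` for `𝔖_p(K_∞)` from the divisibility hypothesis at all layers**: if, for every layer `n`
and level `k`, every `E(K̄_v)`-point rational over the completion of `K_n` at the place above `v` cut out by the chosen
embedding (`H_{K_v} = res⁻¹ Γ_n`) has its `p^c`-multiple `p^k`-divisible by a point fixed by `I_{K_v} ∩ H_{K_v}`, then `p^c`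
kills the pull-back to `Γ_{(K_v)^{nr}} ×_{Γ_K} Γ_n` of every conjugate of every layer class `D.proj n s k` (these are Selmer
classes: `proj_mem`, `selmerTorsionOver` at `(v, g)`). [cite: SilvermanAEC2009, X.§4 proof of Thm. 4.2(b); VII.§6]
[cite: Howard2004HeegnerKolyvagin, Def. 2.1.1 and Lemma 2.2.7] -/
theorem nsmul_proj_conjMap_eq_zero_of_divisible {v : HeightOneSpectrum (𝓞 K)} (c : ℕ)
    (hdiv : ∀ (n k : ℕ) (R : localPoints V (v.adicCompletion K)),
      (∀ τ ∈ localSubgroupOfEmb (κ.layerSubgroup n) (closureEmb (K := K) (v.adicCompletion K)), τ • R = R) →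
      ∃ Q : localPoints V (v.adicCompletion K),
        (∀ τ ∈ absInertia (v.adicCompletion K),
          τ ∈ localSubgroupOfEmb (κ.layerSubgroup n) (closureEmb (K := K) (v.adicCompletion K)) → τ • Q = Q) ∧
        p ^ k • Q = p ^ c • R)
    (n k : ℕ) (s : D.S) (g : absoluteGaloisGroup K) :
    p ^ c • ContinuousCohomology.map (comapRestrict (κ.layerSubgroup n) (ZpExtension.unramifiedRestrictHom v))
        (resPairHom (V.torsionGaloisModule ((p : ℤ) ^ k)).toTopRep
          (DiscreteGaloisModule.toTopRep
            (ContinuousRep.restrict (V.torsionGaloisModule ((p : ℤ) ^ k)) (ZpExtension.unramifiedRestrictHom v)))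
          (ZpExtension.unramifiedRestrictHom v)
          (ZpExtension.idPairHom (V.torsionGaloisModule ((p : ℤ) ^ k)) (ZpExtension.unramifiedRestrictHom v))
          (κ.layerSubgroup n)) 1
        (conjMap (V.torsionGaloisModule ((p : ℤ) ^ k)).toTopRep (κ.layerSubgroup n) g 1 (D.proj n s k)) = 0 := by
  have hsel : D.proj n s k ∈ V.selmerTorsionOver (κ.layerSubgroup n) ((p : ℤ) ^ k) :=
    ((mem_compactSelmerOver_iff (W := V) (H := κ.layerSubgroup n) p (D.proj n s)).1 (D.proj_mem n s)).1 k
  -- `conjMap … g 1` is the tree's `conjH1 … g` on `torsionH1Over` (definitionally, `conjH1_geomTorsion_eq_conjMap`)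
  exact V.nsmul_map_comapRestrict_unramifiedRestrictHom_eq_zero c (hdiv n k)
    (Literature.NumberTheory.EllipticCurves.conjH1 (κ.layerSubgroup n) (geomTorsion V ((p : ℤ) ^ k)) g (D.proj n s k))
    (V.localResTorsionOverOfEmb_conjH1_eq_zero_of_mem_selmerTorsionOver hsel v g)

section Linear

variable (t : ∀ k, (V.torsionGaloisModule ((p : ℤ) ^ (k + 1))).toContRepresentation →ⁱL
    (V.torsionGaloisModule ((p : ℤ) ^ k)).toContRepresentation)
  (ht : ∀ k (P : geomTorsion V ((p : ℤ) ^ (k + 1))), t k P = V.geomTorsionReduce p k P)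
  (I : ZpExtension.EisensteinH1Data (κ.unitTwist (-1)) (fun k ↦ V.torsionGaloisModule ((p : ℤ) ^ k)) t hm)

include ht

/-- **`(S-loc)_a` at `v` ⇒ clause `(S)` at `v` for `h = f s`**: if for all `n, k` and all `g ∈ Γ_K` the power `p^a` kills
the pull-back to `Γ_{(K_v)^{nr}} ×_{Γ_K} Γ_n` of `g · (D.proj n s k)`, then `p^a • loc_v (proj k (f s)) ∈ H¹_{ur}(K_v, T_𝔮/p^k)`
for every `k` (`f = toEisensteinH1Linear`, `proj k (f s) = comp_{k, J_k} s`).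
[cite: Howard2004HeegnerKolyvagin, Def. 2.1.1, §2.2 Lemma 2.2.7 and Prop. 2.2.8] [cite: MazurRubinMemoirs2004, Lemma 5.3.13] -/
theorem nsmul_localization_proj_toEisensteinH1Linear_mem_unramifiedSubgroup (hγ : κ.IsTopGenerator γ)
    (hE : ∀ P : V.toAffine.Point, p • P = 0 → P = 0) (s : D.S) (v : HeightOneSpectrum (𝓞 K)) (a : ℕ)
    (hloc : ∀ (n k : ℕ) (g : absoluteGaloisGroup K),
      p ^ a • ContinuousCohomology.map (comapRestrict (κ.layerSubgroup n) (ZpExtension.unramifiedRestrictHom v))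
        (resPairHom (V.torsionGaloisModule ((p : ℤ) ^ k)).toTopRep
          (DiscreteGaloisModule.toTopRep
            (ContinuousRep.restrict (V.torsionGaloisModule ((p : ℤ) ^ k)) (ZpExtension.unramifiedRestrictHom v)))
          (ZpExtension.unramifiedRestrictHom v)
          (ZpExtension.idPairHom (V.torsionGaloisModule ((p : ℤ) ^ k)) (ZpExtension.unramifiedRestrictHom v))
          (κ.layerSubgroup n)) 1
        (conjMap (V.torsionGaloisModule ((p : ℤ) ^ k)).toTopRep (κ.layerSubgroup n) g 1 (D.proj n s k)) = 0) (k : ℕ) :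
    p ^ a • galoisCohomology.localization
        ((κ.unitTwist (-1)).eisensteinTwist (V.torsionGaloisModule ((p : ℤ) ^ k)) hm k) (Sum.inr v) 1
        (I.proj k (D.toEisensteinH1Linear hm t ht I hγ hE s)) ∈
      unramifiedSubgroup
        (GaloisRep.toLocal v ((κ.unitTwist (-1)).eisensteinTwist (V.torsionGaloisModule ((p : ℤ) ^ k)) hm k)) 1 := by
  rw [D.proj_toEisensteinH1Linear hm t ht I hγ hE s k le_rfl]
  exact D.nsmul_localization_eisensteinComponent_mem_unramifiedSubgroup hm k _ le_rfl s v a (hloc _ k)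

/-- **Clause `(S)` at a bad place `v ∤ p` for `h = f s`, from the divisibility hypothesis**: with `hdiv` as in
`nsmul_proj_conjMap_eq_zero_of_divisible` (exponent `c` uniform in the layer `n` and the level `k` — for an elliptic
curve: `c = v_p` of the geometric component index at `v`, the layers being unramified at `v`), for every `k`,
`p^c • loc_v (proj k (f s)) ∈ H¹_{ur}(K_v, T_𝔮/p^k)` — the hypothesis `hS` of `EisensteinH1Data.mem_ordinarySelmer_of_local`
at `v` with `a = c`. [cite: Howard2004HeegnerKolyvagin, Def. 2.1.1, §2.2 Lemma 2.2.7 and Prop. 2.2.8]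
[cite: SilvermanAEC2009, X.§4 proof of Thm. 4.2(b); VII.§6] -/
theorem nsmul_localization_proj_toEisensteinH1Linear_mem_unramifiedSubgroup_of_divisible (hγ : κ.IsTopGenerator γ)
    (hE : ∀ P : V.toAffine.Point, p • P = 0 → P = 0) (s : D.S) {v : HeightOneSpectrum (𝓞 K)} (c : ℕ)
    (hdiv : ∀ (n k : ℕ) (R : localPoints V (v.adicCompletion K)),
      (∀ τ ∈ localSubgroupOfEmb (κ.layerSubgroup n) (closureEmb (K := K) (v.adicCompletion K)), τ • R = R) →
      ∃ Q : localPoints V (v.adicCompletion K),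
        (∀ τ ∈ absInertia (v.adicCompletion K),
          τ ∈ localSubgroupOfEmb (κ.layerSubgroup n) (closureEmb (K := K) (v.adicCompletion K)) → τ • Q = Q) ∧
        p ^ k • Q = p ^ c • R) (k : ℕ) :
    p ^ c • galoisCohomology.localization
        ((κ.unitTwist (-1)).eisensteinTwist (V.torsionGaloisModule ((p : ℤ) ^ k)) hm k) (Sum.inr v) 1
        (I.proj k (D.toEisensteinH1Linear hm t ht I hγ hE s)) ∈
      unramifiedSubgroup
        (GaloisRep.toLocal v ((κ.unitTwist (-1)).eisensteinTwist (V.torsionGaloisModule ((p : ℤ) ^ k)) hm k)) 1 :=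
  D.nsmul_localization_proj_toEisensteinH1Linear_mem_unramifiedSubgroup hm t ht I hγ hE s v c
    (fun n k g ↦ D.nsmul_proj_conjMap_eq_zero_of_divisible c hdiv n k s g) k

/-- **Clause `(S)` over a finite set of places, in the shape of `hS` of `EisensteinH1Data.mem_ordinarySelmer_of_local`**:
given, at each `v ∈ S` with `v ∤ p`, an exponent `a v` with `(S-loc)_{a v}` for `s`, we get
`∀ v ∈ S, v ∤ p → ∃ a, ∀ k, p^a • loc_v (proj k (f s)) ∈ H¹_{ur}(K_v, T_𝔮/p^k)`.
[cite: Howard2004HeegnerKolyvagin, Def. 2.1.1 and Lemma 2.2.7] [cite: MazurRubinMemoirs2004, Lemma 5.3.13] -/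
theorem toEisensteinH1Linear_hS (hγ : κ.IsTopGenerator γ) (hE : ∀ P : V.toAffine.Point, p • P = 0 → P = 0)
    (S : Finset (HeightOneSpectrum (𝓞 K))) (s : D.S) (a : HeightOneSpectrum (𝓞 K) → ℕ)
    (hloc : ∀ v ∈ S, ((p : ℕ) : 𝓞 K) ∉ v.asIdeal → ∀ (n k : ℕ) (g : absoluteGaloisGroup K),
      p ^ a v • ContinuousCohomology.map (comapRestrict (κ.layerSubgroup n) (ZpExtension.unramifiedRestrictHom v))
        (resPairHom (V.torsionGaloisModule ((p : ℤ) ^ k)).toTopRep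
          (DiscreteGaloisModule.toTopRep
            (ContinuousRep.restrict (V.torsionGaloisModule ((p : ℤ) ^ k)) (ZpExtension.unramifiedRestrictHom v)))
          (ZpExtension.unramifiedRestrictHom v)
          (ZpExtension.idPairHom (V.torsionGaloisModule ((p : ℤ) ^ k)) (ZpExtension.unramifiedRestrictHom v))
          (κ.layerSubgroup n)) 1
        (conjMap (V.torsionGaloisModule ((p : ℤ) ^ k)).toTopRep (κ.layerSubgroup n) g 1 (D.proj n s k)) = 0) :
    ∀ v ∈ S, ((p : ℕ) : 𝓞 K) ∉ v.asIdeal → ∃ a : ℕ, ∀ k,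
      p ^ a • galoisCohomology.localization
          ((κ.unitTwist (-1)).eisensteinTwist (V.torsionGaloisModule ((p : ℤ) ^ k)) hm k) (Sum.inr v) 1
          (I.proj k (D.toEisensteinH1Linear hm t ht I hγ hE s)) ∈
        unramifiedSubgroup
          (GaloisRep.toLocal v ((κ.unitTwist (-1)).eisensteinTwist (V.torsionGaloisModule ((p : ℤ) ^ k)) hm k)) 1 :=
  fun v hvS hpv ↦ ⟨a v, fun k ↦ D.nsmul_localization_proj_toEisensteinH1Linear_mem_unramifiedSubgroup hm t ht I hγ hE s v
    (a v) (hloc v hvS hpv) k⟩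

end Linear

end WeierstrassCurve.LambdaAdicSelmerData

end
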